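import Summits.NavierStokesRegularity.NavierStokesRegularity.Theses.PalasekTowerBreakdown
import Summits.NavierStokesRegularity.FluidComputer.PalasekTowerRegisterGlobalReball
import Summits.NavierStokesRegularity.FluidComputer.PalasekTowerRegisterGlobalRecentre
import Summits.NavierStokesRegularity.FluidComputer.PalasekTowerRegisterGlobalDrift

/-!
# Route `PalasekTowerBreakdown`: THE BALL LEVER by name — the cruxes as typed confine every later readout to
# every ball that confines the design and reads the earlier levels

Cell `ns-blowup`, seat `ns-blowup-fc-prover-3` (g4; prover). Support file for the cruxes
`PalasekTowerBreakdown.HeredityAtOne` (item stmt-NavierStokesRegularity-19249; registered stubs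
`stub_apriori_ceiling_at_one` / `stub_readout_floors_one`), `PalasekTowerBreakdown.HeredityFromTwo` (item -19250)
and `PalasekTowerBreakdown.EpisodeInduction` (item -19178) — supported, NOT closed. LABEL: E–C typing (kernel
compositions of `FluidComputer/PalasekTowerRegisterGlobalReball.lean` with the route decls BY NAME; no named fact,
no `sorry`). WHAT THIS IS NOT: not Navier–Stokes evidence — no stage, flow or tower is constructed; the cruxes
appear only as hypotheses, or negated in the conclusion of TEMPLATES whose premise is ONE EXHIBITED registered
stage (none is known: vacuity stands).

## Reading (numbers of record: wide rates, `c₁ = 1`, `c₂ = 5/3`)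

The register's ball `B̄(0, radius)` is schedule data; the pins survive every re-balling `S ↦ S.reball r` that
still confines datum and force (refuter K49 (B)), and a `routeG` stage survives it as soon as its readouts of
the levels `j ≤ k` lie in `B̄(0, r)` (`Stage.reball`). The cruxes quantify over ALL pinned rigid quiet schedules
and ask the NEXT readouts inside the SAME ball. Hence, by name:

* `palasekTowerBreakdown_heredityAtOne_readsIn_reball`: under `HeredityAtOne`, every registered level-`2` stage
  reads level `2` at `τ₂` (speed `≥ Y₂ ≈ 6140` somewhere, strain `≥ A₂`, an `N₂`-core, `N₂ ≈ 819`) inside EVERY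
  ball `B̄(0, r)`, `r ≤ radius`, that confines `(u₀, f)` and reads levels `0` and `1` — in particular inside the
  smallest such ball, although a structure at the floor speed `Y₁ ≈ 2779` covers `c₅ log N₂ / N₁ ≈ 0.15 ≈ 68/N₁`
  during the rigid window `[τ₁, τ₂]`;
* `palasekTowerBreakdown_episodeInduction_readsIn_all`: under `EpisodeInduction` (K2G) THE WHOLE TOWER of every
  registered stage is read inside every ball that confines the design and reads levels `0` and `1`;
  `palasekTowerBreakdown_heredityFromTwo_readsIn_all`: under `HeredityFromTwo`, the same from levels `0, 1, 2`;
* TEMPLATES `palasekTowerBreakdown_not_heredityAtOne_of_not_readsIn` (stage form) /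
  `…_not_heredityAtOne_of_continuation_speed_lt` (plain-continuation form: ONE registered level-`1` stage, ONE
  admissible `r`, and the design's flow computed to `τ₂` with speed `< Y₂` throughout `B̄(0, r)`), and the
  level-`k` forms for `EpisodeInduction` (`k ≥ 1`) and `HeredityFromTwo` (`k ≥ 2`).

The geometric conjunct is UNINTENDED (the route's why-texts speak of compaction toward a core, never of a ball
pinned to the origin); a registered stage violating it would be a MISSTATEMENT-class refutation (repair: a
level-indexed or conclusion-side radius), not a verdict on autonomous heredity. The UPPER stub
`AprioriCeilingAt 1` is radius-free and untouched; the LOWER stub `ReadoutFloorsAt 1` carries the radius three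
times (`ReadoutFloorsAt.readsIn_reball`, FluidComputer side).

(g4 append) §3 THE SAME FOR BALLS OF ANY CENTRE (`FluidComputer/PalasekTowerRegisterGlobalRecentre.lean`: re-centring
`S.translate c`, `Schedule.ReadsInBall`): `palasekTowerBreakdown_heredityAtOne_readsInBall` — under `HeredityAtOne`
every registered level-`2` stage reads level `2` inside EVERY ball `B̄(c, r)`, ANY centre and radius (no comparison
with `S.radius`), that confines `(u₀, f)` and reads levels `0`, `1`; `…_not_heredityAtOne_of_continuation_speed_lt_ball`;
`…_episodeInduction_readsInBall_all` / `…_heredityFromTwo_readsInBall_all` (+ templates at level `k`).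

(g4 append 2) §4 THE TYPED REPAIR (r1) BY NAME (`FluidComputer/PalasekTowerRegisterGlobalDrift.lean`): the items of
record imply their drift versions (`palasekTowerBreakdown_heredityAtOne_drift`, `…_episodeInduction_drift`), and the
route's base item with the DRIFT induction of bounded total drift still closes the registered leaf
(`palasekTowerBreakdown_breakdown_of_episodeBase_drift`, no W14).

References: S. Palasek, arXiv:2605.13827 §3.3, §4 [cite: Palasek2026ElementaryModel, §4]; H. Sohr, *The
Navier–Stokes Equations*, Birkhäuser 2001, Ch. V Thm. 1.5.1 [cite: Sohr2001, Ch. V Thm. 1.5.1].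
-/

-- `Summit.<Summit>.<Problem>` is the tree's mandated summit-side namespace (CONVENTIONS §2); for this
-- single-conjunct summit the two coincide, so the duplicate is deliberate.
set_option linter.dupNamespace false

noncomputable section

namespace Summit.NavierStokesRegularity.NavierStokesRegularity.Theorems

open Set MeasureTheory Filter Topology Function Real
open scoped ENNReal ContDiff NNReal
open Summit.NavierStokesRegularity.NavierStokesRegularity.Theses
open Summit.NavierStokesRegularity.FluidComputer.PalasekTowerClayBridge
open Literature.Analysis.FluidPDE

/-! ## §1 Item 19249 `HeredityAtOne` -/

/-- **`HeredityAtOne` yields a level-`2` extension reading level `2` inside any admissible smaller ball.** For a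
pinned (`Λ = 8`, `θ = 6/5`), rigid, quiet wide schedule, a registered level-`1` stage `s`, and `r ≤ radius` such
that `B̄(0, r)` confines `(u₀, f)` and reads levels `0`, `1` of `s`: the crux gives a registered level-`2` extension
of `s` reading level `2` at `τ₂` inside `B̄(0, r)`. [cite: Palasek2026ElementaryModel, §4] -/
theorem palasekTowerBreakdown_heredityAtOne_exists_extends_readsIn (h : PalasekTowerBreakdown.HeredityAtOne)
    {S : Schedule TowerRates.wide} (hP : S.Pins 8 (6 / 5)) (hR : S.Rigid) (hQ : S.Quiet)
    (s : Stage 1 TowerRates.wide S (Margins.routeG TowerRates.wide) 1) {r : ℝ} (hr : r ≤ S.radius)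
    (hc : S.ConfinedTo r) (hs : ∀ j, j ≤ 1 → S.ReadsIn j r (s.u (S.τ j))) :
    ∃ s' : Stage 1 TowerRates.wide S (Margins.routeG TowerRates.wide) 2, s.Extends s' ∧
      S.ReadsIn 2 r (s'.u (S.τ 2)) :=
  HeredityAt.exists_extends_readsIn (k := 1) h hP hR hQ s hr hc hs

/-- **THE BALL LEVER for item 19249.** Under `HeredityAtOne`, EVERY registered level-`2` stage (any margins) of a
pinned rigid quiet wide design reads level `2` at `τ₂` — speed `≥ c₁ Y₂`, strain `≥ c₁ A₂`, an `N₂`-core loop —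
inside EVERY ball `B̄(0, r)`, `r ≤ radius`, that confines `(u₀, f)` and reads levels `0` and `1` of a registered
level-`1` stage of the design (W14-free: `Stage.velocity_eq'`). [cite: Sohr2001, Ch. V Thm. 1.5.1] -/
theorem palasekTowerBreakdown_heredityAtOne_readsIn_reball (h : PalasekTowerBreakdown.HeredityAtOne)
    {S : Schedule TowerRates.wide} (hP : S.Pins 8 (6 / 5)) (hR : S.Rigid) (hQ : S.Quiet)
    (s : Stage 1 TowerRates.wide S (Margins.routeG TowerRates.wide) 1) {r : ℝ} (hr : r ≤ S.radius)
    (hc : S.ConfinedTo r) (hs : ∀ j, j ≤ 1 → S.ReadsIn j r (s.u (S.τ j)))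
    {m' : Margins TowerRates.wide} (s'' : Stage 1 TowerRates.wide S m' 2) : S.ReadsIn 2 r (s''.u (S.τ 2)) :=
  HeredityAt.readsIn_reball (k := 1) h hP hR hQ s hr hc hs s''

/-- **The lever from the level-`2` stage alone**: under `HeredityAtOne`, a registered level-`2` stage whose own
levels `0`, `1` are read inside an admissible `B̄(0, r)` reads level `2` there too. [cite: Sohr2001, Ch. V Thm. 1.5.1] -/
theorem palasekTowerBreakdown_heredityAtOne_readsIn_reball' (h : PalasekTowerBreakdown.HeredityAtOne)
    {S : Schedule TowerRates.wide} (hP : S.Pins 8 (6 / 5)) (hR : S.Rigid) (hQ : S.Quiet)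
    (s'' : Stage 1 TowerRates.wide S (Margins.routeG TowerRates.wide) 2) {r : ℝ} (hr : r ≤ S.radius)
    (hc : S.ConfinedTo r) (hs : ∀ j, j ≤ 1 → S.ReadsIn j r (s''.u (S.τ j))) :
    S.ReadsIn 2 r (s''.u (S.τ 2)) :=
  HeredityAt.readsIn_reball' (k := 1) h hP hR hQ s'' hr hc hs

/-- **TEMPLATE for item 19249 (stage form).** ONE pinned rigid quiet wide design, ONE registered level-`1` stage
`s`, ONE admissible `r ≤ radius` (confining `(u₀, f)`, reading levels `0`, `1` of `s`) such that NO registered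
level-`2` extension of `s` reads level `2` inside `B̄(0, r)` — refutes `HeredityAtOne`. (Vacuity warning: no
registered level-`1` stage is known.) [cite: Palasek2026ElementaryModel, §4] -/
theorem palasekTowerBreakdown_not_heredityAtOne_of_not_readsIn {S : Schedule TowerRates.wide}
    (hP : S.Pins 8 (6 / 5)) (hR : S.Rigid) (hQ : S.Quiet)
    (s : Stage 1 TowerRates.wide S (Margins.routeG TowerRates.wide) 1) {r : ℝ} (hr : r ≤ S.radius)
    (hc : S.ConfinedTo r) (hs : ∀ j, j ≤ 1 → S.ReadsIn j r (s.u (S.τ j)))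
    (hesc : ∀ s' : Stage 1 TowerRates.wide S (Margins.routeG TowerRates.wide) 2, s.Extends s' →
      ¬ S.ReadsIn 2 r (s'.u (S.τ 2))) :
    ¬ PalasekTowerBreakdown.HeredityAtOne := fun h =>
  not_heredityAt_of_not_readsIn (k := 1) hP hR hQ s hr hc hs hesc h

/-- **TEMPLATE for item 19249 (plain-continuation form — compute the design's flow).** ONE registered level-`1`
stage, ONE admissible `r ≤ radius`, and ANY classical finite-energy solution `(v, q)` of the design's system on
`[0, τ₂]` from the Clay datum (it is THE registered flow, `Stage.velocity_eq_of_classical`, no W14, no ceiling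
asked) whose speed at `τ₂` stays `< c₁ Y₂` throughout `B̄(0, r)` — refutes `HeredityAtOne`.
[cite: Sohr2001, Ch. V Thm. 1.5.1] -/
theorem palasekTowerBreakdown_not_heredityAtOne_of_continuation_speed_lt {S : Schedule TowerRates.wide}
    (hP : S.Pins 8 (6 / 5)) (hR : S.Rigid) (hQ : S.Quiet)
    (s : Stage 1 TowerRates.wide S (Margins.routeG TowerRates.wide) 1) {r : ℝ} (hr : r ≤ S.radius)
    (hc : S.ConfinedTo r) (hs : ∀ j, j ≤ 1 → S.ReadsIn j r (s.u (S.τ j)))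
    {v : ℝ → EuclideanSpace ℝ (Fin 3) → EuclideanSpace ℝ (Fin 3)} {q : ℝ → EuclideanSpace ℝ (Fin 3) → ℝ}
    (hv : IsClassicalNSSolutionOn (Icc 0 (S.τ 2)) 1 S.f v q) (hv0 : v 0 = S.u₀)
    (hEv : ∃ C : ℝ≥0∞, C < ⊤ ∧ ∀ t ∈ Icc 0 (S.τ 2), ∫⁻ x, ‖v t x‖ₑ ^ 2 ≤ C)
    (hesc : ∀ x, ‖x‖ ≤ r → ‖v (S.τ 2) x‖ < S.c₁ * TowerRates.wide.Y 2) :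
    ¬ PalasekTowerBreakdown.HeredityAtOne := fun h =>
  not_heredityAt_of_continuation_speed_lt (k := 1) hP hR hQ s hr hc hs hv hv0 hEv hesc h

/-! ## §2 Item 19178 `EpisodeInduction` and item 19250 `HeredityFromTwo` -/

/-- **Item 19178: THE WHOLE TOWER SITS IN EVERY BALL THAT CONFINES THE DESIGN AND READS LEVELS `0`, `1`.** Under
`EpisodeInduction` (K2G of record), for every registered stage at any level `K` of a pinned rigid quiet wide design
and every `r ≤ radius` such that `B̄(0, r)` confines `(u₀, f)` and reads the levels `0` and `1` of the stage, EVERY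
level `j ≤ K` is read inside `B̄(0, r)` (speed `≥ Y_j`, strain `≥ A_j`, an `N_j`-core at `τ_j`, each within `r` of
the origin). [cite: Sohr2001, Ch. V Thm. 1.5.1] -/
theorem palasekTowerBreakdown_episodeInduction_readsIn_all (h : PalasekTowerBreakdown.EpisodeInduction)
    {S : Schedule TowerRates.wide} (hP : S.Pins 8 (6 / 5)) (hR : S.Rigid) (hQ : S.Quiet) {K : ℕ}
    (s : Stage 1 TowerRates.wide S (Margins.routeG TowerRates.wide) K) {r : ℝ} (hr : r ≤ S.radius)
    (hc : S.ConfinedTo r) (hs : ∀ j, j ≤ 1 → j ≤ K → S.ReadsIn j r (s.u (S.τ j))) :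
    ∀ j, j ≤ K → S.ReadsIn j r (s.u (S.τ j)) :=
  (episodeInductionG_iff_heredityFrom_one.1 h).readsIn_all hP hR hQ s hr hc hs

/-- **TEMPLATE for item 19178 at any level `k ≥ 1` (plain-continuation form).** ONE registered level-`k` stage,
ONE admissible `r ≤ radius` reading its levels `j ≤ k`, and the design's flow computed to `τ (k+1)` with speed
`< c₁ Y_{k+1}` throughout `B̄(0, r)` — refutes `EpisodeInduction`. [cite: Sohr2001, Ch. V Thm. 1.5.1] -/
theorem palasekTowerBreakdown_not_episodeInduction_of_continuation_speed_lt {k : ℕ} (hk : 1 ≤ k)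
    {S : Schedule TowerRates.wide} (hP : S.Pins 8 (6 / 5)) (hR : S.Rigid) (hQ : S.Quiet)
    (s : Stage 1 TowerRates.wide S (Margins.routeG TowerRates.wide) k) {r : ℝ} (hr : r ≤ S.radius)
    (hc : S.ConfinedTo r) (hs : ∀ j, j ≤ k → S.ReadsIn j r (s.u (S.τ j)))
    {v : ℝ → EuclideanSpace ℝ (Fin 3) → EuclideanSpace ℝ (Fin 3)} {q : ℝ → EuclideanSpace ℝ (Fin 3) → ℝ}
    (hv : IsClassicalNSSolutionOn (Icc 0 (S.τ (k + 1))) 1 S.f v q) (hv0 : v 0 = S.u₀)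
    (hEv : ∃ C : ℝ≥0∞, C < ⊤ ∧ ∀ t ∈ Icc 0 (S.τ (k + 1)), ∫⁻ x, ‖v t x‖ₑ ^ 2 ≤ C)
    (hesc : ∀ x, ‖x‖ ≤ r → ‖v (S.τ (k + 1)) x‖ < S.c₁ * TowerRates.wide.Y (k + 1)) :
    ¬ PalasekTowerBreakdown.EpisodeInduction := fun h =>
  not_heredityAt_of_continuation_speed_lt hP hR hQ s hr hc hs hv hv0 hEv hesc
    ((episodeInductionG_iff_heredityFrom_one.1 h).heredityAt hk)

/-- **Item 19250: every level is read inside every ball that confines the design and reads levels `0`, `1`, `2`.**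
[cite: Sohr2001, Ch. V Thm. 1.5.1] -/
theorem palasekTowerBreakdown_heredityFromTwo_readsIn_all (h : PalasekTowerBreakdown.HeredityFromTwo)
    {S : Schedule TowerRates.wide} (hP : S.Pins 8 (6 / 5)) (hR : S.Rigid) (hQ : S.Quiet) {K : ℕ}
    (s : Stage 1 TowerRates.wide S (Margins.routeG TowerRates.wide) K) {r : ℝ} (hr : r ≤ S.radius)
    (hc : S.ConfinedTo r) (hs : ∀ j, j ≤ 2 → j ≤ K → S.ReadsIn j r (s.u (S.τ j))) :
    ∀ j, j ≤ K → S.ReadsIn j r (s.u (S.τ j)) :=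
  HeredityFrom.readsIn_all (k₀ := 2) h hP hR hQ s hr hc hs

/-- **TEMPLATE for item 19250 at any level `k ≥ 2` (plain-continuation form).** [cite: Sohr2001, Ch. V Thm. 1.5.1] -/
theorem palasekTowerBreakdown_not_heredityFromTwo_of_continuation_speed_lt {k : ℕ} (hk : 2 ≤ k)
    {S : Schedule TowerRates.wide} (hP : S.Pins 8 (6 / 5)) (hR : S.Rigid) (hQ : S.Quiet)
    (s : Stage 1 TowerRates.wide S (Margins.routeG TowerRates.wide) k) {r : ℝ} (hr : r ≤ S.radius)
    (hc : S.ConfinedTo r) (hs : ∀ j, j ≤ k → S.ReadsIn j r (s.u (S.τ j)))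
    {v : ℝ → EuclideanSpace ℝ (Fin 3) → EuclideanSpace ℝ (Fin 3)} {q : ℝ → EuclideanSpace ℝ (Fin 3) → ℝ}
    (hv : IsClassicalNSSolutionOn (Icc 0 (S.τ (k + 1))) 1 S.f v q) (hv0 : v 0 = S.u₀)
    (hEv : ∃ C : ℝ≥0∞, C < ⊤ ∧ ∀ t ∈ Icc 0 (S.τ (k + 1)), ∫⁻ x, ‖v t x‖ₑ ^ 2 ≤ C)
    (hesc : ∀ x, ‖x‖ ≤ r → ‖v (S.τ (k + 1)) x‖ < S.c₁ * TowerRates.wide.Y (k + 1)) :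
    ¬ PalasekTowerBreakdown.HeredityFromTwo := fun h =>
  not_heredityAt_of_continuation_speed_lt hP hR hQ s hr hc hs hv hv0 hEv hesc
    (HeredityFrom.heredityAt (k₀ := 2) h hk)

/-- **The deciding theorem's three binders, jointly**: under `EpisodeBase ∧ HeredityAtOne ∧ HeredityFromTwo` (the
hypotheses of `PalasekTowerBreakdown.closes`) the realised tower of the base schedule is read, level after level,
inside every ball that confines the base design and reads its levels `0` and `1` — the blow-up the route asserts
happens inside the smallest such ball. [cite: Palasek2026ElementaryModel, §4] -/
theorem palasekTowerBreakdown_closes_readsIn_all (h₂ : PalasekTowerBreakdown.HeredityAtOne)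
    (h₃ : PalasekTowerBreakdown.HeredityFromTwo) {S : Schedule TowerRates.wide} (hP : S.Pins 8 (6 / 5))
    (hR : S.Rigid) (hQ : S.Quiet) {K : ℕ} (s : Stage 1 TowerRates.wide S (Margins.routeG TowerRates.wide) K)
    {r : ℝ} (hr : r ≤ S.radius) (hc : S.ConfinedTo r)
    (hs : ∀ j, j ≤ 1 → j ≤ K → S.ReadsIn j r (s.u (S.τ j))) :
    ∀ j, j ≤ K → S.ReadsIn j r (s.u (S.τ j)) :=
  palasekTowerBreakdown_episodeInduction_readsIn_all (PalasekTowerBreakdown.EpisodeInductionGlueBy_holds h₂ h₃)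
    hP hR hQ s hr hc hs

/-! ## §3 (g4 append) The same for balls of ANY centre -/

/-- **THE BALL LEVER for item 19249, any centre.** Under `HeredityAtOne`, EVERY registered level-`2` stage (any
margins) of a pinned rigid quiet wide design reads level `2` at `τ₂` — speed `≥ c₁ Y₂`, strain `≥ c₁ A₂`, an
`N₂`-core loop — inside EVERY ball `B̄(c, r)`, ANY centre `c` and ANY radius `r` (no comparison with `S.radius`),
that confines `(u₀, f)` and reads the levels `0` and `1` of a registered level-`1` stage (re-centre and re-ball
the design, `Stage.translated_velocity_eq`; no W14). [cite: Sohr2001, Ch. V Thm. 1.5.1] -/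
theorem palasekTowerBreakdown_heredityAtOne_readsInBall (h : PalasekTowerBreakdown.HeredityAtOne)
    {S : Schedule TowerRates.wide} (hP : S.Pins 8 (6 / 5)) (hR : S.Rigid) (hQ : S.Quiet)
    (s : Stage 1 TowerRates.wide S (Margins.routeG TowerRates.wide) 1) {c : EuclideanSpace ℝ (Fin 3)} {r : ℝ}
    (hc : (S.translate c).ConfinedTo r) (hs : ∀ j, j ≤ 1 → S.ReadsInBall j c r (s.u (S.τ j)))
    {m' : Margins TowerRates.wide} (s'' : Stage 1 TowerRates.wide S m' 2) :
    S.ReadsInBall 2 c r (s''.u (S.τ 2)) :=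
  HeredityAt.readsInBall (k := 1) h hP hR hQ s hc hs s''

/-- **TEMPLATE for item 19249, any centre (plain-continuation form).** ONE registered level-`1` stage, ONE ball
`B̄(c, r)` confining `(u₀, f)` (i.e. `∀ x, r < ‖x - c‖ → u₀ x = 0 ∧ f t x = 0`, `Schedule.confinedTo_translate_iff`)
and reading its levels `0`, `1`, and ANY classical finite-energy solution `(v, q)` of the design's system on
`[0, τ₂]` from the Clay datum whose speed at `τ₂` stays `< c₁ Y₂` throughout `B̄(c, r)` — refutes `HeredityAtOne`.
(Vacuity warning: no registered level-`1` stage is known.) [cite: Sohr2001, Ch. V Thm. 1.5.1] -/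
theorem palasekTowerBreakdown_not_heredityAtOne_of_continuation_speed_lt_ball {S : Schedule TowerRates.wide}
    (hP : S.Pins 8 (6 / 5)) (hR : S.Rigid) (hQ : S.Quiet)
    (s : Stage 1 TowerRates.wide S (Margins.routeG TowerRates.wide) 1) {c : EuclideanSpace ℝ (Fin 3)} {r : ℝ}
    (hc : (S.translate c).ConfinedTo r) (hs : ∀ j, j ≤ 1 → S.ReadsInBall j c r (s.u (S.τ j)))
    {v : ℝ → EuclideanSpace ℝ (Fin 3) → EuclideanSpace ℝ (Fin 3)} {q : ℝ → EuclideanSpace ℝ (Fin 3) → ℝ}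
    (hv : IsClassicalNSSolutionOn (Icc 0 (S.τ 2)) 1 S.f v q) (hv0 : v 0 = S.u₀)
    (hEv : ∃ C : ℝ≥0∞, C < ⊤ ∧ ∀ t ∈ Icc 0 (S.τ 2), ∫⁻ x, ‖v t x‖ₑ ^ 2 ≤ C)
    (hesc : ∀ x, ‖x - c‖ ≤ r → ‖v (S.τ 2) x‖ < S.c₁ * TowerRates.wide.Y 2) :
    ¬ PalasekTowerBreakdown.HeredityAtOne := fun h =>
  not_heredityAt_of_continuation_speed_lt_ball (k := 1) hP hR hQ s hc hs hv hv0 hEv hesc h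

/-- **Item 19178, any centre: THE WHOLE TOWER SITS IN EVERY BALL THAT CONFINES THE DESIGN AND READS LEVELS
`0`, `1`.** [cite: Sohr2001, Ch. V Thm. 1.5.1] -/
theorem palasekTowerBreakdown_episodeInduction_readsInBall_all (h : PalasekTowerBreakdown.EpisodeInduction)
    {S : Schedule TowerRates.wide} (hP : S.Pins 8 (6 / 5)) (hR : S.Rigid) (hQ : S.Quiet) {K : ℕ}
    (s : Stage 1 TowerRates.wide S (Margins.routeG TowerRates.wide) K) {c : EuclideanSpace ℝ (Fin 3)} {r : ℝ}
    (hc : (S.translate c).ConfinedTo r) (hs : ∀ j, j ≤ 1 → j ≤ K → S.ReadsInBall j c r (s.u (S.τ j))) :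
    ∀ j, j ≤ K → S.ReadsInBall j c r (s.u (S.τ j)) :=
  (episodeInductionG_iff_heredityFrom_one.1 h).readsInBall_all hP hR hQ s hc hs

/-- **TEMPLATE for item 19178 at any level `k ≥ 1`, any centre (plain-continuation form).**
[cite: Sohr2001, Ch. V Thm. 1.5.1] -/
theorem palasekTowerBreakdown_not_episodeInduction_of_continuation_speed_lt_ball {k : ℕ} (hk : 1 ≤ k)
    {S : Schedule TowerRates.wide} (hP : S.Pins 8 (6 / 5)) (hR : S.Rigid) (hQ : S.Quiet)
    (s : Stage 1 TowerRates.wide S (Margins.routeG TowerRates.wide) k) {c : EuclideanSpace ℝ (Fin 3)} {r : ℝ}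
    (hc : (S.translate c).ConfinedTo r) (hs : ∀ j, j ≤ k → S.ReadsInBall j c r (s.u (S.τ j)))
    {v : ℝ → EuclideanSpace ℝ (Fin 3) → EuclideanSpace ℝ (Fin 3)} {q : ℝ → EuclideanSpace ℝ (Fin 3) → ℝ}
    (hv : IsClassicalNSSolutionOn (Icc 0 (S.τ (k + 1))) 1 S.f v q) (hv0 : v 0 = S.u₀)
    (hEv : ∃ C : ℝ≥0∞, C < ⊤ ∧ ∀ t ∈ Icc 0 (S.τ (k + 1)), ∫⁻ x, ‖v t x‖ₑ ^ 2 ≤ C)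
    (hesc : ∀ x, ‖x - c‖ ≤ r → ‖v (S.τ (k + 1)) x‖ < S.c₁ * TowerRates.wide.Y (k + 1)) :
    ¬ PalasekTowerBreakdown.EpisodeInduction := fun h =>
  not_heredityAt_of_continuation_speed_lt_ball hP hR hQ s hc hs hv hv0 hEv hesc
    ((episodeInductionG_iff_heredityFrom_one.1 h).heredityAt hk)

/-- **Item 19250, any centre**: every level is read inside every ball of any centre that confines the design and
reads levels `0`, `1`, `2`. [cite: Sohr2001, Ch. V Thm. 1.5.1] -/
theorem palasekTowerBreakdown_heredityFromTwo_readsInBall_all (h : PalasekTowerBreakdown.HeredityFromTwo)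
    {S : Schedule TowerRates.wide} (hP : S.Pins 8 (6 / 5)) (hR : S.Rigid) (hQ : S.Quiet) {K : ℕ}
    (s : Stage 1 TowerRates.wide S (Margins.routeG TowerRates.wide) K) {c : EuclideanSpace ℝ (Fin 3)} {r : ℝ}
    (hc : (S.translate c).ConfinedTo r) (hs : ∀ j, j ≤ 2 → j ≤ K → S.ReadsInBall j c r (s.u (S.τ j))) :
    ∀ j, j ≤ K → S.ReadsInBall j c r (s.u (S.τ j)) :=
  HeredityFrom.readsInBall_all (k₀ := 2) h hP hR hQ s hc hs

/-- **TEMPLATE for item 19250 at any level `k ≥ 2`, any centre (plain-continuation form).**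
[cite: Sohr2001, Ch. V Thm. 1.5.1] -/
theorem palasekTowerBreakdown_not_heredityFromTwo_of_continuation_speed_lt_ball {k : ℕ} (hk : 2 ≤ k)
    {S : Schedule TowerRates.wide} (hP : S.Pins 8 (6 / 5)) (hR : S.Rigid) (hQ : S.Quiet)
    (s : Stage 1 TowerRates.wide S (Margins.routeG TowerRates.wide) k) {c : EuclideanSpace ℝ (Fin 3)} {r : ℝ}
    (hc : (S.translate c).ConfinedTo r) (hs : ∀ j, j ≤ k → S.ReadsInBall j c r (s.u (S.τ j)))
    {v : ℝ → EuclideanSpace ℝ (Fin 3) → EuclideanSpace ℝ (Fin 3)} {q : ℝ → EuclideanSpace ℝ (Fin 3) → ℝ}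
    (hv : IsClassicalNSSolutionOn (Icc 0 (S.τ (k + 1))) 1 S.f v q) (hv0 : v 0 = S.u₀)
    (hEv : ∃ C : ℝ≥0∞, C < ⊤ ∧ ∀ t ∈ Icc 0 (S.τ (k + 1)), ∫⁻ x, ‖v t x‖ₑ ^ 2 ≤ C)
    (hesc : ∀ x, ‖x - c‖ ≤ r → ‖v (S.τ (k + 1)) x‖ < S.c₁ * TowerRates.wide.Y (k + 1)) :
    ¬ PalasekTowerBreakdown.HeredityFromTwo := fun h =>
  not_heredityAt_of_continuation_speed_lt_ball hP hR hQ s hc hs hv hv0 hEv hesc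
    (HeredityFrom.heredityAt (k₀ := 2) h hk)

/-! ## §4 (g4 append 2) The typed repair (r1) by name -/

/-- **Item 19249 implies its drift version** for every allowance `ρ ≥ 0` (enlarging the conclusion ball is free).
[cite: Palasek2026ElementaryModel, §4] -/
theorem palasekTowerBreakdown_heredityAtOne_drift (h : PalasekTowerBreakdown.HeredityAtOne) {ρ : ℝ} (hρ : 0 ≤ ρ) :
    HeredityAtDrift 1 ρ :=
  HeredityAt.drift (k := 1) h hρ

/-- **Item 19178 (K2G) implies the drift induction** for every nonnegative drift schedule.
[cite: Palasek2026ElementaryModel, §4] -/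
theorem palasekTowerBreakdown_episodeInduction_drift (h : PalasekTowerBreakdown.EpisodeInduction) {ρ : ℕ → ℝ}
    (hρ : ∀ k, 0 ≤ ρ k) : EpisodeInductionDrift ρ :=
  EpisodeInductionG.drift h hρ

/-- **THE REPAIRED PAIR STILL CLOSES THE REGISTERED LEAF — no W14.** The route's base item `EpisodeBase` (K1G) with
the DRIFT induction `EpisodeInductionDrift ρ` (conclusion-side balls `radius + ρ k`, `ρ ≥ 0`, partial sums `≤ B`)
gives Clay (C) `NavierStokesBreakdownR3`: the drift chain in the growing balls, moved into the bounded ball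
`radius + B`, glued by `Realisation.ofChain`, rescaled to every viscosity, PATH-B bridge. So adopting repair (r1) of
the ball lever costs the route nothing on the closing side. [cite: FeffermanClay2006, (C)] -/
theorem palasekTowerBreakdown_breakdown_of_episodeBase_drift (h₁ : PalasekTowerBreakdown.EpisodeBase)
    {ρ : ℕ → ℝ} (h₂ : EpisodeInductionDrift ρ) (hρ : ∀ k, 0 ≤ ρ k) {B : ℝ}
    (hB : ∀ n, ∑ j ∈ Finset.range n, ρ (j + 1) ≤ B) :
    Summit.NavierStokesRegularity.NavierStokesRegularity.NavierStokesBreakdownR3 :=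
  navierStokesBreakdownR3_of_episodesDrift h₁ h₂ hρ hB

/-- The same with a summable nonnegative drift schedule. [cite: FeffermanClay2006, (C)] -/
theorem palasekTowerBreakdown_breakdown_of_episodeBase_drift_summable (h₁ : PalasekTowerBreakdown.EpisodeBase)
    {ρ : ℕ → ℝ} (h₂ : EpisodeInductionDrift ρ) (hρ : ∀ k, 0 ≤ ρ k) (hsum : Summable ρ) :
    Summit.NavierStokesRegularity.NavierStokesRegularity.NavierStokesBreakdownR3 :=
  navierStokesBreakdownR3_of_episodesDrift_summable h₁ h₂ hρ hsum

/-- **Consistency check**: at zero drift the repaired closer is the route's own composition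
(`EpisodeBase → EpisodeInduction → (C)`, W14-free along PATH B). [cite: FeffermanClay2006, (C)] -/
theorem palasekTowerBreakdown_breakdown_of_episodeBase_induction (h₁ : PalasekTowerBreakdown.EpisodeBase)
    (h₂ : PalasekTowerBreakdown.EpisodeInduction) :
    Summit.NavierStokesRegularity.NavierStokesRegularity.NavierStokesBreakdownR3 :=
  palasekTowerBreakdown_breakdown_of_episodeBase_drift h₁ (palasekTowerBreakdown_episodeInduction_drift h₂ fun _ => le_rfl)
    (fun _ => le_rfl) (B := 0) (fun n => by simp)

end Summit.NavierStokesRegularity.NavierStokesRegularity.Theorems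

end
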